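import Summits.KontsevichZagierPeriods.KontsevichZagierPeriods.Theorems.OctahedralSymmetryOctahedralSpanAllWeightsInteriorAvoiding
import HarnessLib

/-!
# Crux `OctahedralSpanAllWeights` (stmt-KontsevichZagierPeriods-9659), line `Sketch`, block F1:
# the conjugation family (K) of `e₁`-free relations in depth three (all weights)

Companion of `…RegularE0InteriorTricolour.lean` (worker of the F1 core `stub_regular_e0_core`, lead c3;
see the lab summary in that file's docstring). The `e₁`-free part of the relation module `rel` in an
F1 layer is NOT spanned by the `e₁`-free generators and the lifts of reducible shorter words: exact rank
computations (lengths `5 … 10`, depth three) need two further families of COMBINATIONS of finite double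
shuffles whose terms with a pole `1` (letter `0`) cancel — (R), by commutativity of the shuffle product,
and (K), by the conjugation `1 ↔ 3`. This file proves family (K) in depth three, for all weights:

`relK a b :  [1 4^a 3 4^{b+1} 2] + [1 4^{a+1} 2 4^b 2] − [3 4^a 1 4^{b+1} 2] − [3 4^{a+1} 2 4^b 2]
   ∈ rel ⊔ e0Lower (1 4^a 3 4^{b+1} 2)`.

Mechanism. The finite double shuffle `fds(((1,1)), ((1,3),(a+1,2),(b+1,0)))` (the letter `3` against the
word `1 4^a 3 4^b 3`) has seven stuffle terms; the three in which the part `(1,1)` meets the first part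
`(1,3)` (cumulative exponent `0`, pole `1`) are `[1 0 S] + [3 0 S] − [4 0 S]`, `S = 4^a 2 4^b 2`, a
combination invariant under `1 ↔ 3`. Hence the difference with the conjugate double shuffle
`fds(((1,3)), ((1,1),(a+1,2),(b+1,0)))` is `e₁`-free; its words with `a + b + 1` letters `4` are the four
displayed merges, and the other stuffle terms and the two shuffles `3 ш (1 4^a 3 4^b 3)`, `1 ш (3 4^a 1 4^b 1)`
are `e₁`-free convergent words with `a + b` letters `4`. In the lab this family supplies exactly one
otherwise missing dimension of the depth-three layer in every length `6 … 10` (the block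
`4^a {13, 31} 4^b 2` of the residual core).

Sources: J. Zhao, Doc. Math. 15 (2010), §2 Def. 2.4, (FDS) [Zhao2010]; M. E. Hoffman, J. Algebra 194
(1997), §2 [Hoffman1997].
-/

noncomputable section

namespace Summit.KontsevichZagierPeriods.OctahedralSymmetry.OctaSpan.RegularE0

open Literature.NumberTheory.Transcendental Literature.NumberTheory.Transcendental.LevelFour

/-- **Family (K), depth three (all weights).** For all `a, b ≥ 0`:
`[1 4^a 3 4^{b+1} 2] + [1 4^{a+1} 2 4^b 2] − [3 4^a 1 4^{b+1} 2] − [3 4^{a+1} 2 4^b 2] ∈ rel ⊔ e0Lower`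
— the difference of the finite double shuffle `fds(((1,1)), ((1,3),(a+1,2),(b+1,0)))` and its `1 ↔ 3`
conjugate: their terms with a letter `0` coincide (`[1 0 S]`, `[3 0 S]`, `[4 0 S]`, `S = 4^a 2 4^b 2`), the
displayed words are the merges into the second and third parts, and the remaining stuffle and shuffle
terms are `e₁`-free convergent words with fewer letters `4`. [cite: Zhao2010, §2 (FDS)] -/
theorem relK (a b : ℕ) :
    sym (1 :: (List.replicate a 4 ++ 3 :: (List.replicate (b + 1) 4 ++ [2]))) +
      sym (1 :: (List.replicate (a + 1) 4 ++ 2 :: (List.replicate b 4 ++ [2]))) -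
      sym (3 :: (List.replicate a 4 ++ 1 :: (List.replicate (b + 1) 4 ++ [2]))) -
      sym (3 :: (List.replicate (a + 1) 4 ++ 2 :: (List.replicate b 4 ++ [2]))) ∈
      rel ⊔ e0Lower (1 :: (List.replicate a 4 ++ 3 :: (List.replicate (b + 1) 4 ++ [2]))) := by
  -- the two conjugate pairs of indices
  have hk : IsConvergentIdx [((1 : ℕ), (1 : Fin 4))] := isConvergentIdx_cons le_rfl (fun _ => by decide) (by simp)
  have hk' : IsConvergentIdx [((1 : ℕ), (3 : Fin 4))] := isConvergentIdx_cons le_rfl (fun _ => by decide) (by simp)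
  have hl : IsConvergentIdx [((1 : ℕ), (3 : Fin 4)), (a + 1, 2), (b + 1, 0)] :=
    isConvergentIdx_cons le_rfl (fun _ => by decide) (by intro p hp; simp at hp; rcases hp with rfl | rfl <;> simp)
  have hl' : IsConvergentIdx [((1 : ℕ), (1 : Fin 4)), (a + 1, 2), (b + 1, 0)] :=
    isConvergentIdx_cons le_rfl (fun _ => by decide) (by intro p hp; simp at hp; rcases hp with rfl | rfl <;> simp)
  have hgen : fdsGen [((1 : ℕ), (1 : Fin 4))] [((1 : ℕ), (3 : Fin 4)), (a + 1, 2), (b + 1, 0)] ∈ rel :=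
    mem_rel_of_isGen (IsGen.fds hk hl)
  have hgen' : fdsGen [((1 : ℕ), (3 : Fin 4))] [((1 : ℕ), (1 : Fin 4)), (a + 1, 2), (b + 1, 0)] ∈ rel :=
    mem_rel_of_isGen (IsGen.fds hk' hl')
  -- the stuffles (seven terms each)
  have hst : stuffleIdx [((1 : ℕ), (1 : Fin 4))] [((1 : ℕ), (3 : Fin 4)), (a + 1, 2), (b + 1, 0)] =
      [[(1, 1), (1, 3), (a + 1, 2), (b + 1, 0)], [(1, 3), (1, 1), (a + 1, 2), (b + 1, 0)],
        [(1, 3), (a + 1, 2), (1, 1), (b + 1, 0)], [(1, 3), (a + 1, 2), (b + 1, 0), (1, 1)],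
        [(1, 3), (a + 1, 2), (1 + (b + 1), 1 + 0)], [(1, 3), (1 + (a + 1), 1 + 2), (b + 1, 0)],
        [(1 + 1, 1 + 3), (a + 1, 2), (b + 1, 0)]] := rfl
  have hst' : stuffleIdx [((1 : ℕ), (3 : Fin 4))] [((1 : ℕ), (1 : Fin 4)), (a + 1, 2), (b + 1, 0)] =
      [[(1, 3), (1, 1), (a + 1, 2), (b + 1, 0)], [(1, 1), (1, 3), (a + 1, 2), (b + 1, 0)],
        [(1, 1), (a + 1, 2), (1, 3), (b + 1, 0)], [(1, 1), (a + 1, 2), (b + 1, 0), (1, 3)],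
        [(1, 1), (a + 1, 2), (1 + (b + 1), 3 + 0)], [(1, 1), (1 + (a + 1), 3 + 2), (b + 1, 0)],
        [(1 + 1, 3 + 1), (a + 1, 2), (b + 1, 0)]] := rfl
  -- the words
  have hA1 : word [((1 : ℕ), (1 : Fin 4)), (1, 3), (a + 1, 2), (b + 1, 0)] =
      3 :: 0 :: (List.replicate a 4 ++ 2 :: (List.replicate b 4 ++ [2])) := by simp [word, wordAux, fin4_neg]
  have hA2 : word [((1 : ℕ), (3 : Fin 4)), (1, 1), (a + 1, 2), (b + 1, 0)] =
      1 :: 0 :: (List.replicate a 4 ++ 2 :: (List.replicate b 4 ++ [2])) := by simp [word, wordAux, fin4_neg]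
  have hA3 : word [((1 : ℕ), (3 : Fin 4)), (a + 1, 2), (1, 1), (b + 1, 0)] =
      1 :: (List.replicate a 4 ++ 3 :: 2 :: (List.replicate b 4 ++ [2])) := by simp [word, wordAux, fin4_neg]
  have hA4 : word [((1 : ℕ), (3 : Fin 4)), (a + 1, 2), (b + 1, 0), (1, 1)] =
      1 :: (List.replicate a 4 ++ 3 :: (List.replicate b 4 ++ [3, 2])) := by simp [word, wordAux, fin4_neg]
  have hA5 : word [((1 : ℕ), (3 : Fin 4)), (a + 1, 2), (1 + (b + 1), 1 + 0)] =
      1 :: (List.replicate a 4 ++ 3 :: (List.replicate (b + 1) 4 ++ [2])) := by simp [word, wordAux, fin4_neg]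
  have hA6 : word [((1 : ℕ), (3 : Fin 4)), (1 + (a + 1), 1 + 2), (b + 1, 0)] =
      1 :: (List.replicate (a + 1) 4 ++ 2 :: (List.replicate b 4 ++ [2])) := by simp [word, wordAux, fin4_neg]
  have hA7 : word [((1 + 1 : ℕ), (1 + 3 : Fin 4)), (a + 1, 2), (b + 1, 0)] =
      4 :: 0 :: (List.replicate a 4 ++ 2 :: (List.replicate b 4 ++ [2])) := by simp [word, wordAux, fin4_neg]
  have hB3 : word [((1 : ℕ), (1 : Fin 4)), (a + 1, 2), (1, 3), (b + 1, 0)] =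
      3 :: (List.replicate a 4 ++ 1 :: 2 :: (List.replicate b 4 ++ [2])) := by simp [word, wordAux, fin4_neg]
  have hB4 : word [((1 : ℕ), (1 : Fin 4)), (a + 1, 2), (b + 1, 0), (1, 3)] =
      3 :: (List.replicate a 4 ++ 1 :: (List.replicate b 4 ++ [1, 2])) := by simp [word, wordAux, fin4_neg]
  have hB5 : word [((1 : ℕ), (1 : Fin 4)), (a + 1, 2), (1 + (b + 1), 3 + 0)] =
      3 :: (List.replicate a 4 ++ 1 :: (List.replicate (b + 1) 4 ++ [2])) := by simp [word, wordAux, fin4_neg]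
  have hB6 : word [((1 : ℕ), (1 : Fin 4)), (1 + (a + 1), 3 + 2), (b + 1, 0)] =
      3 :: (List.replicate (a + 1) 4 ++ 2 :: (List.replicate b 4 ++ [2])) := by simp [word, wordAux, fin4_neg]
  have hB7 : word [((1 + 1 : ℕ), (3 + 1 : Fin 4)), (a + 1, 2), (b + 1, 0)] =
      4 :: 0 :: (List.replicate a 4 ++ 2 :: (List.replicate b 4 ++ [2])) := by simp [word, wordAux, fin4_neg]
  have hwk : word [((1 : ℕ), (1 : Fin 4))] = [3] := by simp [word, wordAux, fin4_neg]
  have hwk' : word [((1 : ℕ), (3 : Fin 4))] = [1] := by simp [word, wordAux, fin4_neg]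
  have hwl : word [((1 : ℕ), (3 : Fin 4)), (a + 1, 2), (b + 1, 0)] =
      1 :: (List.replicate a 4 ++ 3 :: (List.replicate b 4 ++ [3])) := by simp [word, wordAux, fin4_neg]
  have hwl' : word [((1 : ℕ), (1 : Fin 4)), (a + 1, 2), (b + 1, 0)] =
      3 :: (List.replicate a 4 ++ 1 :: (List.replicate b 4 ++ [1])) := by simp [word, wordAux, fin4_neg]
  -- the two finite double shuffles, expanded
  have hfds : fdsGen [((1 : ℕ), (1 : Fin 4))] [((1 : ℕ), (3 : Fin 4)), (a + 1, 2), (b + 1, 0)] =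
      sym (3 :: 0 :: (List.replicate a 4 ++ 2 :: (List.replicate b 4 ++ [2]))) +
        sym (1 :: 0 :: (List.replicate a 4 ++ 2 :: (List.replicate b 4 ++ [2]))) +
        sym (1 :: (List.replicate a 4 ++ 3 :: 2 :: (List.replicate b 4 ++ [2]))) +
        sym (1 :: (List.replicate a 4 ++ 3 :: (List.replicate b 4 ++ [3, 2]))) -
        sym (1 :: (List.replicate a 4 ++ 3 :: (List.replicate (b + 1) 4 ++ [2]))) -
        sym (1 :: (List.replicate (a + 1) 4 ++ 2 :: (List.replicate b 4 ++ [2]))) -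
        sym (4 :: 0 :: (List.replicate a 4 ++ 2 :: (List.replicate b 4 ++ [2]))) -
        toQ (shuffle [3] (1 :: (List.replicate a 4 ++ 3 :: (List.replicate b 4 ++ [3])))) := by
    simp only [fdsGen, stuffleSigned, hst, List.map_cons, List.map_nil, List.length_cons,
      List.length_nil, hA1, hA2, hA3, hA4, hA5, hA6, hA7, hwk, hwl, ofTerms_cons, ofTerms_nil, map_add,
      map_zero, toQ_single]
    norm_num
    abel
  have hfds' : fdsGen [((1 : ℕ), (3 : Fin 4))] [((1 : ℕ), (1 : Fin 4)), (a + 1, 2), (b + 1, 0)] =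
      sym (1 :: 0 :: (List.replicate a 4 ++ 2 :: (List.replicate b 4 ++ [2]))) +
        sym (3 :: 0 :: (List.replicate a 4 ++ 2 :: (List.replicate b 4 ++ [2]))) +
        sym (3 :: (List.replicate a 4 ++ 1 :: 2 :: (List.replicate b 4 ++ [2]))) +
        sym (3 :: (List.replicate a 4 ++ 1 :: (List.replicate b 4 ++ [1, 2]))) -
        sym (3 :: (List.replicate a 4 ++ 1 :: (List.replicate (b + 1) 4 ++ [2]))) -
        sym (3 :: (List.replicate (a + 1) 4 ++ 2 :: (List.replicate b 4 ++ [2]))) -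
        sym (4 :: 0 :: (List.replicate a 4 ++ 2 :: (List.replicate b 4 ++ [2]))) -
        toQ (shuffle [1] (3 :: (List.replicate a 4 ++ 1 :: (List.replicate b 4 ++ [1])))) := by
    simp only [fdsGen, stuffleSigned, hst', List.map_cons, List.map_nil, List.length_cons,
      List.length_nil, hA1, hA2, hB3, hB4, hB5, hB6, hB7, hwk', hwl', ofTerms_cons, ofTerms_nil, map_add,
      map_zero, toQ_single]
    norm_num
    abel
  -- the lower terms
  have h14 : (1 : Fin 5) ≠ 4 := by decide
  have h34 : (3 : Fin 5) ≠ 4 := by decide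
  have h24 : (2 : Fin 5) ≠ 4 := by decide
  have hlen : ((1 : Fin 5) :: (List.replicate a 4 ++ 3 :: (List.replicate (b + 1) 4 ++ [2]))).length =
      a + b + 4 := by
    simp; omega
  have hcnt : ((1 : Fin 5) :: (List.replicate a 4 ++ 3 :: (List.replicate (b + 1) 4 ++ [2]))).count 4 =
      a + b + 1 := by
    simp [h14, h34, h24]; omega
  have hT3 : sym (1 :: (List.replicate a 4 ++ 3 :: 2 :: (List.replicate b 4 ++ [2]))) ∈
      e0Lower (1 :: (List.replicate a 4 ++ 3 :: (List.replicate (b + 1) 4 ++ [2]))) := by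
    refine sym_mem_e0Lower ?_ ⟨by simp, ?_⟩ ?_ ?_
    · rw [hlen]; simp; omega
    · rw [show (1 : Fin 5) :: (List.replicate a 4 ++ 3 :: 2 :: (List.replicate b 4 ++ [2])) =
        (1 :: (List.replicate a 4 ++ 3 :: 2 :: List.replicate b 4)) ++ [2] by simp,
        List.getLast?_append, List.getLast?_singleton, Option.some_or]; decide
    · simp [List.count_replicate]
    · rw [hcnt]; simp [h14, h34, h24]
  have hT4 : sym (1 :: (List.replicate a 4 ++ 3 :: (List.replicate b 4 ++ [3, 2]))) ∈
      e0Lower (1 :: (List.replicate a 4 ++ 3 :: (List.replicate (b + 1) 4 ++ [2]))) := by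
    refine sym_mem_e0Lower ?_ ⟨by simp, ?_⟩ ?_ ?_
    · rw [hlen]; simp; omega
    · rw [show (1 : Fin 5) :: (List.replicate a 4 ++ 3 :: (List.replicate b 4 ++ [3, 2])) =
        (1 :: (List.replicate a 4 ++ 3 :: (List.replicate b 4 ++ [3]))) ++ [2] by simp,
        List.getLast?_append, List.getLast?_singleton, Option.some_or]; decide
    · simp [List.count_replicate]
    · rw [hcnt]; simp [h14, h34, h24]
  have hT3' : sym (3 :: (List.replicate a 4 ++ 1 :: 2 :: (List.replicate b 4 ++ [2]))) ∈
      e0Lower (1 :: (List.replicate a 4 ++ 3 :: (List.replicate (b + 1) 4 ++ [2]))) := by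
    refine sym_mem_e0Lower ?_ ⟨by simp, ?_⟩ ?_ ?_
    · rw [hlen]; simp; omega
    · rw [show (3 : Fin 5) :: (List.replicate a 4 ++ 1 :: 2 :: (List.replicate b 4 ++ [2])) =
        (3 :: (List.replicate a 4 ++ 1 :: 2 :: List.replicate b 4)) ++ [2] by simp,
        List.getLast?_append, List.getLast?_singleton, Option.some_or]; decide
    · simp [List.count_replicate]
    · rw [hcnt]; simp [h14, h34, h24]
  have hT4' : sym (3 :: (List.replicate a 4 ++ 1 :: (List.replicate b 4 ++ [1, 2]))) ∈
      e0Lower (1 :: (List.replicate a 4 ++ 3 :: (List.replicate (b + 1) 4 ++ [2]))) := by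
    refine sym_mem_e0Lower ?_ ⟨by simp, ?_⟩ ?_ ?_
    · rw [hlen]; simp; omega
    · rw [show (3 : Fin 5) :: (List.replicate a 4 ++ 1 :: (List.replicate b 4 ++ [1, 2])) =
        (3 :: (List.replicate a 4 ++ 1 :: (List.replicate b 4 ++ [1]))) ++ [2] by simp,
        List.getLast?_append, List.getLast?_singleton, Option.some_or]; decide
    · simp [List.count_replicate]
    · rw [hcnt]; simp [h14, h34, h24]
  have hSh : toQ (shuffle [3] (1 :: (List.replicate a 4 ++ 3 :: (List.replicate b 4 ++ [3])))) ∈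
      e0Lower (1 :: (List.replicate a 4 ++ 3 :: (List.replicate (b + 1) 4 ++ [2]))) := by
    refine toQ_shuffle_mem _ _ _ fun w hw => ?_
    have hp := MZV.perm_of_mem_shuffleWord _ _ hw
    have hcv : IsConvergent (1 :: (List.replicate a 4 ++ 3 :: (List.replicate b 4 ++ [3]))) := by
      rw [← hwl]; exact isConvergent_word hl
    refine sym_mem_e0Lower ?_ ?_ ?_ ?_
    · rw [hp.length_eq, hlen]; simp; omega
    · exact isConvergent_of_mem_shuffleWord ⟨by simp, by simp⟩ hcv hw
    · rw [hp.count_eq]; simp [List.count_replicate]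
    · rw [hp.count_eq, hcnt]; simp [h14, h34]
  have hSh' : toQ (shuffle [1] (3 :: (List.replicate a 4 ++ 1 :: (List.replicate b 4 ++ [1])))) ∈
      e0Lower (1 :: (List.replicate a 4 ++ 3 :: (List.replicate (b + 1) 4 ++ [2]))) := by
    refine toQ_shuffle_mem _ _ _ fun w hw => ?_
    have hp := MZV.perm_of_mem_shuffleWord _ _ hw
    have hcv : IsConvergent (3 :: (List.replicate a 4 ++ 1 :: (List.replicate b 4 ++ [1]))) := by
      rw [← hwl']; exact isConvergent_word hl'
    refine sym_mem_e0Lower ?_ ?_ ?_ ?_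
    · rw [hp.length_eq, hlen]; simp; omega
    · exact isConvergent_of_mem_shuffleWord ⟨by simp, by simp⟩ hcv hw
    · rw [hp.count_eq]; simp [List.count_replicate]
    · rw [hp.count_eq, hcnt]; simp [h14, h34]
  -- assemble
  rw [Submodule.mem_sup]
  refine ⟨-(fdsGen [((1 : ℕ), (1 : Fin 4))] [((1 : ℕ), (3 : Fin 4)), (a + 1, 2), (b + 1, 0)] -
      fdsGen [((1 : ℕ), (3 : Fin 4))] [((1 : ℕ), (1 : Fin 4)), (a + 1, 2), (b + 1, 0)]),
    rel.neg_mem (rel.sub_mem hgen hgen'), _,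
    Submodule.add_mem _ (Submodule.sub_mem _ (Submodule.sub_mem _ (Submodule.sub_mem _
      (Submodule.add_mem _ hT3 hT4) hT3') hT4') hSh) hSh', ?_⟩
  rw [hfds, hfds']
  abel

end Summit.KontsevichZagierPeriods.OctahedralSymmetry.OctaSpan.RegularE0

namespace Summit.KontsevichZagierPeriods.OctahedralSymmetry.OctaSpan

open Literature.NumberTheory.Transcendental Literature.NumberTheory.Transcendental.LevelFour RegularE0

/-- **Block F1, the conjugation family (K) in depth three, all weights** (registered stub
`stub_regular_e0_relK` of the crux `OctahedralSpanAllWeights`, line `Sketch`):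
`[1 4^a 3 4^{b+1} 2] + [1 4^{a+1} 2 4^b 2] − [3 4^a 1 4^{b+1} 2] − [3 4^{a+1} 2 4^b 2]` lies in `rel ⊔ e0Lower` —
`RegularE0.relK`. [cite: Zhao2010, §2 (FDS)] -/
theorem stub_regular_e0_relK (a b : ℕ) :
    sym (1 :: (List.replicate a 4 ++ 3 :: (List.replicate (b + 1) 4 ++ [2]))) +
      sym (1 :: (List.replicate (a + 1) 4 ++ 2 :: (List.replicate b 4 ++ [2]))) -
      sym (3 :: (List.replicate a 4 ++ 1 :: (List.replicate (b + 1) 4 ++ [2]))) -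
      sym (3 :: (List.replicate (a + 1) 4 ++ 2 :: (List.replicate b 4 ++ [2]))) ∈
      rel ⊔ RegularE0.e0Lower (1 :: (List.replicate a 4 ++ 3 :: (List.replicate (b + 1) 4 ++ [2]))) :=
  relK a b

end Summit.KontsevichZagierPeriods.OctahedralSymmetry.OctaSpan

end
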